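import Literature.MathematicalPhysics.QuantumFieldTheory.Balaban1983to89.B15Prop1IntrinsicOfRecord

/-!
# `Balaban1983to89.B15Prop1GradientFromValue` — [Balaban1989LargeFieldI] Prop. 1 p. 194 / [Balaban1989LargeFieldII] pp. 357–359: ★★★ THE GRADIENT
# LETTER (L3) OF PROPOSITION 1 [IV] IS NOT INDEPENDENT — given the holomorphic extension (J1) it follows from the NONNEGATIVITY of (1.77) and the
# SMALLNESS OF ITS VALUE at the extended regular datum (an order-zero letter), with an explicit constant and no dimension factor

Honest framing: statement-level skeleton of published theorems with citation tags; proofs where landed; nothing here is a claim about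
the Yang–Mills mass gap.  Count-neutral kernel work on Bałaban AS PRINTED; NOT a discharge of node N12; nothing continuum ∕ OS ∕ mass-gap ∕ Clay.

## What is printed

[Balaban1989LargeFieldII] p. 359 (PDF 5) ll. 1–16, after (1.13): *«Using Proposition 4 [15] and the fixed point theorem for contractive mappings, we
can easily prove that the above equation has exactly one solution, which has a bound equal to twice a bound of the right-hand side of the equation,
i.e., it can be bounded by 2γ₀⁻¹2d(100M)⁵B₃²4ε_k.»* — the right-hand side of (1.13) is `−(P₀H*_{1,k}Δ₁H_{1,k}P₀)⁻¹P₀H*_{1,k}J_{k,Z}`, and the factor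
`B₃²4ε_k` is print's bound of the GRADIENT `H*_{1,k}J_{k,Z}` of the function (1.77) [IV] p. 194 *«V_k↾_Λ → A(U_{k,Z}(V_k)) (1.77)»* at the datum
(expansion (1.11) p. 358).  In the intrinsic reading of the chain (`B15Prop1IntrinsicReading`, p513628; `B15Prop1IntrinsicOfRecord`, p527900) this is
the letter (L3) `hJ : ‖rGrad (sliceFn … (A ∘ U_{k,Z}) (ext V_k)) 0‖ ≤ cJ·ε` at `ε`-regular data.

## What is here (kernel-checked, sorry-free)

§1 `norm_rGrad_le_of_nonneg` — pure finite-dimensional complex analysis on the gauge-fixed slice: if `g : GaugeSlice S T ℝ³ → ℝ` is `≥ 0` on the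
   ball `‖X‖ < R` and has a complex-differentiable extension `G` to the ball of radius `R` of the complexified slice, bounded by `𝓐` there, then for
   every `0 < s < R`
   `‖∇g(0)‖ ≤ g(0)∕s + 4𝓐s∕R²`.
   PROOF: the tree's second-order Schwarz estimate `Literature.Analysis.Complex.norm_sub_sub_fderiv_le_of_forall_mem_ball_norm_le`
   (`‖G(Y) − G(0) − DG(0)Y‖ ≤ 4𝓐(‖Y‖∕R)²`) tested at the ONE real point `Y = ι(−s·∇g(0)∕‖∇g(0)‖)` (no coordinate directions, hence no dimension
   factor), `DG(0)(ιu) = Dg(0)u = ⟪u, ∇g(0)⟫` (`B15Prop1SliceTaylorCalculus.fderiv_cplxSlice_apply`), and `0 ≤ g(u)`.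
   `norm_rGrad_sliceFn_le_of_nonneg` — the same for print's function in the gauge-fixed coordinates `sliceFn S T f V = B ↦ f(exp(i·ιA B)·V)` from ONE
   holomorphic extension of `B′ ↦ f(exp(iB′)·V)` on the sup-ball of `𝔤ᶜ`-valued bond fields (the data of `slice_package_of_holomorphic`), `f ≥ 0`.
   `hJ_of_value` — the letter (L3) IN THE EXACT SHAPE the chain consumes, DERIVED from the `p̃ = 0` section of (J1), `f ≥ 0` and the VALUE letter
   (V) `f i (ext i V_k) ≤ cA·ε²` at `ε`-regular data (`ε ≤ eR`), with `s := Rε∕(2eR)`: constant `2cA·eR∕R + 2𝓐∕(R·eR)`, i.e. any `cJ` dominating it.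
§2 ★★ `exists_domain_prop1Printed_lfVarOn_ofFun_intrinsic_analytic_ofValue` — the bare-function endpoint `B15Prop1IntrinsicOfFun.…_ofFun_intrinsic_analytic`
   (p526992) with (L3) `hJ` REPLACED by `hf0 : 0 ≤ f`, (V) `hV` and the domination `hcJ'`.
§3 ★★★ `exists_domain_prop1Printed_lfVarOn_std_su2_box_intrinsic_analytic_ofRecord_ofValue` — the record endpoint
   `B15Prop1IntrinsicOfRecord.…_ofRecord` (p527900) at `bg := Node00.bgOfRecord av reg` with (L3) REPLACED by (V) about print's (1.77) VALUE
   `A(U_{k,Z}(ext V_k)) = fun177std bg M₁ Z k (ext V_k) ≤ cA·ε²`; `0 ≤ A` is `Setup.wilsonAction4_nonneg` (each `1 − Re tr U(∂p) ≥ 0`).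
   WHAT A CONSUMER NOW SUPPLIES for Proposition 1 at the record: (J1) `hGj`, (L2) `hlead` + `hsm`∕`hγle`, (V) `hV` (+ `hcJ'` bookkeeping), the
   class invariance `hreg`, `k i ≤ m + K`, structure — (V) is an ORDER-ZERO statement (print: [Balaban1985Variational] Thm 1 (8) p. 279, the
   regularity `|∂U_{k,Z} − 1| < O(1)B₃M²εη²` of [IV] p. 193 ll. 17–20 on the component, summed with `1 − Re tr U_p ≤ |U_p − 1|²∕2`).

## HONEST SCOPE — the trade

Print's route to (L3) is Λ-LOCAL ((1.11)∕(1.13): `J_{k,Z}` enters through `H*_{1,k}`, bound `B₃²4ε_k`, no volume).  This module's route trades that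
locality for letters the chain ALREADY displays: the constant `2cA·eR∕R + 2𝓐∕(R·eR)` carries the total action of the minimiser on its component
(`cA`) and the polydisc bound of (J1) (`𝓐`).  By [IV] p. 192 (PDF 18) *«U_{k,Z} … (1.74) … It is defined in each component of Z separately»*, the
components being those satisfying the conditions (i)–(ii) (p. 192: *«Λ … is a rectangular parallelepiped contained in a cube of the size 100M»*),
these are PER-COMPONENT quantities, polynomial in `100M`, `R_k`, `L` like print's `(100M)⁵` and `O(1)M⁶R_k` — not lattice-volume quantities; the typed
(1.78) constant of the chain (`B₅ = 2a·hst·cJ∕γ + b + 1`) inherits them through `cJ`.  Whether a consumer prefers print's `B₃²4ε_k` (through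
`H_{1,k}` of record, [15] Prop. 9) or (V) is its choice: both endpoints stand side by side.  Nothing of NODE 00 is declared or assumed beyond the
displayed letters; no instance, no notation, no attribute.
-/

noncomputable section

open Set Finset Metric Filter
open scoped BigOperators Matrix RealInnerProductSpace Real InnerProductSpace Topology

namespace Literature.MathematicalPhysics.QuantumFieldTheory.Balaban1983to89.B15Prop1GradientFromValue

open B15DeterminingSets GaugeField B16Sect1Backgrounds B15Prop1Carrier B8Eq17ClassAkV1
open B15Prop1SliceTaylorCalculus B15Prop1LocalLettersOfFun B15Prop1IntrinsicOfFun B15Prop1IntrinsicOfRecord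
open B15Prop1AnalyticExtClause (cplxVec cplxSlice anExt cplxSlice_apply norm_cplxSlice norm_cplxVec)
open B15Prop1ChartCalculusSU2 (E3)
open T4CubeChartGnomonic (SU2)
open B15Prop1ChartSU2 (su2Chart)
open B15Prop1SliceCoordinates (GaugeSlice ιA freeBonds norm_ιA_apply_le)
open T4AxialGaugeSmallField (castSite boxPlaqs)
open B6BondElimination (unitVec)
open B16Eq18Proof (box)
open B15Extension193 (extend)
open B15ShellGauge193 (shellGauge)
open B5Bounds167Lattice (formDk ofRealCfg)
open B14.Eq213DetSet B14.Eq216Concrete B15Sect1Instances B15Eq177GaugeInvariance B15Eq177ValueInvariance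
open Literature.MathematicalPhysics.QuantumFieldTheory.BalabanImbrieJaffe1984to88.BIJ85Eq453GaugeField
open B15Prop1ParametricZeroBranch (differentiableOn_section norm_prodMk_lt)
open Literature.Analysis.Complex (norm_sub_sub_fderiv_le_of_forall_mem_ball_norm_le)

/-! ## §1 The gradient of a nonnegative function with a bounded holomorphic extension -/

section Slice

variable {P : Params} {k : ℕ} [DecidableEq (PBond P k)] (S : Set (Site P k)) (T : Finset (PBond P k))

/-- On the open ball `‖X‖ < R` the agreement `G ∘ ι = g` holds near every point (bookkeeping, as in `B15Prop1SliceTaylorCalculus`). [folklore] -/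
private theorem eventually_agree {g : GaugeSlice S T E3 → ℝ} {G : GaugeSlice S T (EuclideanSpace ℂ (Fin 3)) → ℂ} {R : ℝ}
    (hagree : ∀ X : GaugeSlice S T E3, ‖X‖ < R → G (cplxSlice S T X) = (g X : ℂ)) {X : GaugeSlice S T E3} (hX : ‖X‖ < R) :
    ∀ᶠ X' in 𝓝 X, G (cplxSlice S T X') = (g X' : ℂ) := by
  have hopen : IsOpen {X' : GaugeSlice S T E3 | ‖X'‖ < R} := isOpen_lt continuous_norm continuous_const
  exact Filter.eventually_of_mem (hopen.mem_nhds hX) fun X' hX' => hagree X' hX'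

/-- ★ **THE GRADIENT OF A NONNEGATIVE FUNCTION WITH A BOUNDED HOLOMORPHIC EXTENSION.**  Let `g : GaugeSlice S T ℝ³ → ℝ` be `≥ 0` on the ball
`‖X‖ < R` and let `G` be complex-differentiable on the ball of radius `R` of the complexified slice, bounded by `𝓐` there, with `G(ιX) = g(X)` for
`‖X‖ < R` ([LF-II] p. 359 *«The above equations, bounds and statements are valid for 𝔤ᶜ-valued fields»*).  Then for every `0 < s < R`:
`‖∇g(0)‖ ≤ g(0)∕s + 4𝓐s∕R²`.  (Second-order Schwarz at the single point `ι(−s·∇g(0)∕‖∇g(0)‖)`: `0 ≤ g(u) ≤ g(0) − s‖∇g(0)‖ + 4𝓐(s∕R)²`.)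
[cite: Balaban1989LargeFieldII, (1.11) p.358, (1.13) p.359 («it can be bounded by 2γ₀⁻¹2d(100M)⁵B₃²4ε_k»)] -/
theorem norm_rGrad_le_of_nonneg {g : GaugeSlice S T E3 → ℝ} {G : GaugeSlice S T (EuclideanSpace ℂ (Fin 3)) → ℂ} {R 𝓐 s : ℝ}
    (hGd : DifferentiableOn ℂ G (ball 0 R)) (hGb : ∀ Y ∈ ball (0 : GaugeSlice S T (EuclideanSpace ℂ (Fin 3))) R, ‖G Y‖ ≤ 𝓐)
    (hagree : ∀ X : GaugeSlice S T E3, ‖X‖ < R → G (cplxSlice S T X) = (g X : ℂ))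
    (hpos : ∀ X : GaugeSlice S T E3, ‖X‖ < R → 0 ≤ g X) (hs : 0 < s) (hsR : s < R) :
    ‖rGrad S T g 0‖ ≤ g 0 / s + 4 * 𝓐 * s / R ^ 2 := by
  have hR : 0 < R := hs.trans hsR
  have h0R : ‖(0 : GaugeSlice S T E3)‖ < R := by rw [norm_zero]; exact hR
  have h𝓐 : 0 ≤ 𝓐 := (norm_nonneg _).trans (hGb 0 (mem_ball_self hR))
  have hg0 : 0 ≤ g 0 := hpos 0 h0R
  set J : GaugeSlice S T E3 := rGrad S T g 0 with hJdef
  by_cases hJ0 : J = 0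
  · rw [hJ0, norm_zero]; positivity
  have hJn : 0 < ‖J‖ := norm_pos_iff.2 hJ0
  -- the test point `u = −(s∕‖J‖)·J`, `‖u‖ = s < R`
  set u : GaugeSlice S T E3 := (-(s / ‖J‖)) • J with hudef
  have hun : ‖u‖ = s := by
    rw [hudef, norm_smul, norm_neg, Real.norm_of_nonneg (div_nonneg hs.le hJn.le), div_mul_cancel₀ _ hJn.ne']
  have huR : ‖u‖ < R := by rw [hun]; exact hsR
  have hY : cplxSlice S T u ∈ ball (0 : GaugeSlice S T (EuclideanSpace ℂ (Fin 3))) R := by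
    rw [mem_ball_zero_iff, norm_cplxSlice]; exact huR
  -- second-order Schwarz at `ι u`
  have hT := norm_sub_sub_fderiv_le_of_forall_mem_ball_norm_le hGd hGb hY
  rw [sub_zero, norm_cplxSlice, hun] at hT
  -- the three terms are real: `G(ιu) = g u`, `G 0 = g 0`, `DG(0)(ιu) = Dg(0)u = ⟪u, J⟫ = −s‖J‖`
  have hG0 : G 0 = (g 0 : ℂ) := by
    have h := hagree 0 h0R
    rwa [map_zero] at h
  have hGu : G (cplxSlice S T u) = (g u : ℂ) := hagree u huR
  have hD : fderiv ℂ G 0 (cplxSlice S T u) = ((fderiv ℝ g 0 u : ℝ) : ℂ) := by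
    have hGat : DifferentiableAt ℂ G (cplxSlice S T 0) := by
      rw [map_zero]; exact hGd.differentiableAt (isOpen_ball.mem_nhds (mem_ball_self hR))
    have h := fderiv_cplxSlice_apply S T hGat (eventually_agree S T hagree h0R) u
    rwa [map_zero] at h
  have hDu : fderiv ℝ g 0 u = -(s * ‖J‖) := by
    rw [← inner_rGrad, ← hJdef, hudef, real_inner_smul_left, real_inner_self_eq_norm_sq]
    field_simp
  rw [hGu, hG0, hD, hDu] at hT
  have hcast : (g u : ℂ) - (g 0 : ℂ) - ((-(s * ‖J‖) : ℝ) : ℂ) = ((g u - g 0 + s * ‖J‖ : ℝ) : ℂ) := by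
    push_cast; ring
  rw [hcast, Complex.norm_real, Real.norm_eq_abs] at hT
  -- `0 ≤ g u ≤ g 0 − s‖J‖ + 4𝓐(s∕R)²`
  have hgu : 0 ≤ g u := hpos u huR
  have h1 : s * ‖J‖ ≤ g 0 + 4 * 𝓐 * (s / R) ^ 2 := by
    have h2 := (abs_le.1 hT).2
    linarith
  have h3 : ‖J‖ ≤ (g 0 + 4 * 𝓐 * (s / R) ^ 2) / s := by
    rw [le_div_iff₀ hs]; linarith
  calc ‖J‖ ≤ (g 0 + 4 * 𝓐 * (s / R) ^ 2) / s := h3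
    _ = g 0 / s + 4 * 𝓐 * s / R ^ 2 := by field_simp

/-- ★ **THE SAME FOR PRINT'S FUNCTION IN THE GAUGE-FIXED COORDINATES.**  Let `f ≥ 0` on scale-`k` gauge fields and let `G` be complex-differentiable on
the sup-ball `‖B′‖ < R` of `𝔤ᶜ`-valued bond fields, bounded by `𝓐`, with `G(cplxVec B′) = f(exp(iB′)·V)` for real `‖B′‖ < R` (the data of
`B15Prop1SliceTaylorCalculus.slice_package_of_holomorphic`; [15] Thm 1 ∕ [LF-II] p. 359 *«valid for 𝔤ᶜ-valued fields»*).  Then for every `0 < s < R`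
the slice function `g = sliceFn S T f V` (`g(B) = f(exp(i·ιA B)·V)`, `g(0) = f(V)`) has `‖∇g(0)‖ ≤ f(V)∕s + 4𝓐s∕R²`.
[cite: Balaban1989LargeFieldII, (1.11) p.358, (1.13) p.359; Balaban1989LargeFieldI, (1.77) p.194] -/
theorem norm_rGrad_sliceFn_le_of_nonneg (f : GaugeField P k SU2 → ℝ) (hf0 : ∀ V, 0 ≤ f V) (V : GaugeField P k SU2) {R 𝓐 s : ℝ}
    (G : VecField P k (EuclideanSpace ℂ (Fin 3)) → ℂ) (hGd : DifferentiableOn ℂ G (ball 0 R))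
    (hGb : ∀ Y ∈ ball (0 : VecField P k (EuclideanSpace ℂ (Fin 3))) R, ‖G Y‖ ≤ 𝓐)
    (hGr : ∀ B' : VecField P k E3, ‖B'‖ < R → G (cplxVec B') = ((f (expMul su2Chart B' V) : ℝ) : ℂ))
    (hs : 0 < s) (hsR : s < R) :
    ‖rGrad S T (sliceFn S T f V) 0‖ ≤ f V / s + 4 * 𝓐 * s / R ^ 2 := by
  -- the complex slice function `Gs = G ∘ ιAc` and its three properties (as in `slice_package_of_holomorphic`)
  set Gs : GaugeSlice S T (EuclideanSpace ℂ (Fin 3)) → ℂ := fun Y' => G (ιAc S T Y') with hGs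
  have hmaps : MapsTo (ιAc S T) (ball (0 : GaugeSlice S T (EuclideanSpace ℂ (Fin 3))) R) (ball 0 R) := by
    intro Y hY
    rw [mem_ball_zero_iff] at hY ⊢
    exact (norm_ιAc_le S T Y).trans_lt hY
  have hGsd : DifferentiableOn ℂ Gs (ball 0 R) := hGd.comp (ιAc S T).differentiable.differentiableOn hmaps
  have hGsb : ∀ Y ∈ ball (0 : GaugeSlice S T (EuclideanSpace ℂ (Fin 3))) R, ‖Gs Y‖ ≤ 𝓐 := fun Y hY => hGb _ (hmaps hY)
  have hGsr : ∀ X : GaugeSlice S T E3, ‖X‖ < R → Gs (cplxSlice S T X) = ((sliceFn S T f V X : ℝ) : ℂ) := by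
    intro X hX
    simp only [hGs, ιAc_cplxSlice, sliceFn_apply]
    exact hGr _ ((norm_ιA_le S T X).trans_lt hX)
  have h := norm_rGrad_le_of_nonneg S T hGsd hGsb hGsr (fun X _ => hf0 _) hs hsR
  have h0 : sliceFn S T f V 0 = f V := by rw [sliceFn_apply, map_zero, expMul_zero]
  rwa [h0] at h

end Slice

/-! ## §2 (L3) from (J1) and the value letter (V), over a bare function family -/

section OfFun

open Classical

variable {P : Params}

/-- `cplxVec 0 = 0` (bookkeeping; private in `B15Prop1IntrinsicOfFun`). [folklore] -/
private theorem cplxVec_zero {k : ℕ} : cplxVec (0 : VecField P k E3) = 0 := by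
  funext b; ext i; simp [cplxVec]

/-- ★★ **(L3) IN THE SHAPE THE CHAIN CONSUMES, FROM (J1) + `f ≥ 0` + THE VALUE LETTER (V).**  Given the joint holomorphic extension `hGj` of
`(p, B′) ↦ f i (exp(iB′)·ext(exp(ip)V_k))` on the sup-ball of radius `R i` with bound `𝓐 i` at `eR i`-regular data (letter (J1) of
`B15Prop1IntrinsicOfFun.…_ofFun_intrinsic_analytic`), `0 ≤ f i`, and (V) `f i (ext i V_k) ≤ cA·ε²` at `ε`-regular data (`0 < ε ≤ eR i`), the slice
gradient at `0` obeys `‖∇g(0)‖ ≤ cJ·ε` for every `cJ ≥ 2cA·eR i∕R i + 2𝓐 i∕(R i·eR i)` (test radius `s = R i·ε∕(2eR i)` in `norm_rGrad_sliceFn_le_of_nonneg`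
applied to the `p̃ = 0` section of `𝒢`).  Print's bound of the same gradient is `B₃²4ε_k` ((1.13) p. 359, through `H*_{1,k}J_{k,Z}` of (1.11)).
[cite: Balaban1989LargeFieldII, (1.11) p.358, (1.13) p.359; Balaban1989LargeFieldI, (1.77) p.194, p.193] -/
theorem hJ_of_value {ι : Type} (Z Λ : ι → Set (Site P 0)) (k : ι → ℕ) (f : ∀ i, GaugeField P (k i) SU2 → ℝ)
    (hf0 : ∀ i V, 0 ≤ f i V) (eR : ι → ℝ) (heR : ∀ i, 0 < eR i) (T : ∀ i, Finset (PBond P (k i)))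
    (ext : ∀ i, GaugeField P (k i) SU2 → GaugeField P (k i) SU2)
    {R 𝓐 : ι → ℝ} (hR : ∀ i, 0 < R i) {cA cJ : ℝ}
    (hGj : ∀ i Vk, PlaqSmallOn (plaqsInside (pts (k i) (Z i ∩ (Λ i)ᶜ))) (eR i) Vk →
      ∃ 𝒢 : VecField P (k i) (EuclideanSpace ℂ (Fin 3)) × VecField P (k i) (EuclideanSpace ℂ (Fin 3)) → ℂ,
        DifferentiableOn ℂ 𝒢 (ball 0 (R i)) ∧
        (∀ z ∈ ball (0 : VecField P (k i) (EuclideanSpace ℂ (Fin 3)) × VecField P (k i) (EuclideanSpace ℂ (Fin 3))) (R i), ‖𝒢 z‖ ≤ 𝓐 i) ∧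
        ∀ p B' : VecField P (k i) E3, ‖p‖ < R i → ‖B'‖ < R i →
          𝒢 (cplxVec p, cplxVec B') = ((f i (expMul su2Chart B' (ext i (expMul su2Chart p Vk))) : ℝ) : ℂ))
    (hV : ∀ i ε Vk, 0 < ε → ε ≤ eR i → PlaqSmallOn (plaqsInside (pts (k i) (Z i ∩ (Λ i)ᶜ))) ε Vk → f i (ext i Vk) ≤ cA * ε ^ 2)
    (hcJ' : ∀ i, 2 * cA * eR i / R i + 2 * 𝓐 i / (R i * eR i) ≤ cJ) :
    ∀ i ε Vk, 0 < ε → ε ≤ eR i → PlaqSmallOn (plaqsInside (pts (k i) (Z i ∩ (Λ i)ᶜ))) ε Vk →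
      ‖rGrad (pts (k i) (Λ i)) (T i) (sliceFn (pts (k i) (Λ i)) (T i) (f i) (ext i Vk)) 0‖ ≤ cJ * ε := by
  intro i ε Vk hε hεR hVk
  -- the datum is `eR`-regular, so (J1) applies; take the `p̃ = 0` section of `𝒢`
  have hVR : PlaqSmallOn (plaqsInside (pts (k i) (Z i ∩ (Λ i)ᶜ))) (eR i) Vk := fun q hq => (hVk q hq).trans_le hεR
  obtain ⟨𝒢, hd, hb, hr⟩ := hGj i Vk hVR
  have h0R : ‖(0 : VecField P (k i) (EuclideanSpace ℂ (Fin 3)))‖ < R i := by rw [norm_zero]; exact hR i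
  have hGd : DifferentiableOn ℂ (fun B => 𝒢 (0, B)) (ball 0 (R i)) := differentiableOn_section 𝒢 hd h0R
  have hGb : ∀ Y ∈ ball (0 : VecField P (k i) (EuclideanSpace ℂ (Fin 3))) (R i), ‖𝒢 (0, Y)‖ ≤ 𝓐 i := fun Y hY =>
    hb _ (by rw [mem_ball_zero_iff] at hY ⊢; exact norm_prodMk_lt h0R hY)
  have hGr : ∀ B' : VecField P (k i) E3, ‖B'‖ < R i →
      𝒢 (0, cplxVec B') = ((f i (expMul su2Chart B' (ext i Vk)) : ℝ) : ℂ) := by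
    intro B' hB'
    have h := hr 0 B' (by rw [norm_zero]; exact hR i) hB'
    rwa [cplxVec_zero, expMul_zero] at h
  -- the test radius `s = R ε∕(2 eR) ≤ R∕2 < R`
  have hRi := hR i
  have heRi := heR i
  set s : ℝ := R i * ε / (2 * eR i) with hsdef
  have hs0 : 0 < s := by positivity
  have hsR : s < R i := by
    rw [hsdef, div_lt_iff₀ (by positivity)]
    nlinarith
  have h := norm_rGrad_sliceFn_le_of_nonneg (pts (k i) (Λ i)) (T i) (f i) (hf0 i) (ext i Vk) (fun B => 𝒢 (0, B)) hGd hGb hGr hs0 hsR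
  have hfv : f i (ext i Vk) ≤ cA * ε ^ 2 := hV i ε Vk hε hεR hVk
  have hRne : R i ≠ 0 := hRi.ne'
  have heRne : eR i ≠ 0 := heRi.ne'
  have hεne : ε ≠ 0 := hε.ne'
  calc ‖rGrad (pts (k i) (Λ i)) (T i) (sliceFn (pts (k i) (Λ i)) (T i) (f i) (ext i Vk)) 0‖
      ≤ f i (ext i Vk) / s + 4 * 𝓐 i * s / R i ^ 2 := h
    _ ≤ cA * ε ^ 2 / s + 4 * 𝓐 i * s / R i ^ 2 := add_le_add (div_le_div_of_nonneg_right hfv hs0.le) le_rfl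
    _ = (2 * cA * eR i / R i + 2 * 𝓐 i / (R i * eR i)) * ε := by
      rw [hsdef]
      field_simp
      ring
    _ ≤ cJ * ε := mul_le_mul_of_nonneg_right (hcJ' i) hε.le

/-- ★★ **PROPOSITION 1 [IV] WITH ITS ANALYTIC-EXTENSION CLAUSE, IN THE INTRINSIC READING, OVER A BARE FUNCTION FAMILY — WITH (L3) REPLACED BY THE VALUE
LETTER (V).**  The endpoint `B15Prop1IntrinsicOfFun.exists_domain_prop1Printed_lfVarOn_ofFun_intrinsic_analytic` (p526992) VERBATIM, except that the
gradient letter `hJ` is gone: in its place `hf0 : 0 ≤ f i`, (V) `hV : f i (ext i V_k) ≤ cA·ε²` at `ε`-regular data (`ε ≤ eR i`) and the bookkeeping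
`hcJ' : 2cA·eR i∕R i + 2𝓐 i∕(R i·eR i) ≤ cJ` (`hJ_of_value`).  Letters left: (J1) `hGj`, (L2) `hlead` + `hsm`∕`hγle`, (V), `hf`, structure.
[cite: Balaban1989LargeFieldI, Prop. 1 (1.77)–(1.78) p.194 (incl. the last clause), p.193; Balaban1989LargeFieldII, (1.7)–(1.9) p.358, (1.11) p.358,
(1.12)–(1.13) p.359; Balaban1985Variational, Prop. 9 p.309] -/
theorem exists_domain_prop1Printed_lfVarOn_ofFun_intrinsic_analytic_ofValue (hd3 : 3 ≤ P.d) (h0 : 0 < P.d) {ι : Type}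
    (Z Λ : ι → Set (Site P 0)) (k : ι → ℕ) (M : ι → ℝ)
    (f : ∀ i, GaugeField P (k i) SU2 → ℝ) (hf0 : ∀ i V, 0 ≤ f i V)
    (hf : ∀ i (u : GaugeTransf P (k i) SU2) (V : GaugeField P (k i) SU2), f i (gaugeAct u V) = f i V)
    (eR : ι → ℝ) (heR : ∀ i, 0 < eR i)
    (T : ∀ i, Finset (PBond P (k i)))
    (lo hi : ι → Fin P.d → ℤ) (n : ι → ℕ) (hn : ∀ i κ, hi i κ ≤ lo i κ + n i) (hN : ∀ i, n i + 2 < P.sitesPerDir (k i))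
    (hbox : ∀ i, pts (k i) (Λ i) = (castSite '' Set.Icc (lo i) (hi i) : Set (Site P (k i))))
    (hZ : ∀ i, (boxPlaqs (lo i - 1) (hi i + 1) : Set (Plaq P (k i))) ⊆ plaqsInside (pts (k i) (Z i)))
    (hTG0 : ∀ i, T i = @Finset.image (Fin P.d → ℤ) (PBond P (k i)) (fun a b => Classical.propDecidable (a = b))
      (fun x => (⟨castSite (x - unitVec ⟨0, h0⟩), ⟨0, h0⟩⟩ : PBond P (k i))) (box (fun κ => (hi i κ - lo i κ + 1).toNat) (lo i)))
    (hN5 : ∀ i κ, ((hi i κ - lo i κ + 1).toNat : ℤ) + 5 < P.sitesPerDir (k i))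
    (K : ι → ℕ) (hK1 : ∀ i, 1 ≤ K i) (hKn : ∀ i κ, (hi i κ - lo i κ + 1).toNat ≤ K i)
    (ext : ∀ i, GaugeField P (k i) SU2 → GaugeField P (k i) SU2)
    (hext : ∀ i Vk, ext i Vk = extend (pts (k i) (Λ i)) (shellGauge Vk (lo i) (hi i)) Vk)
    (hlohi : ∀ i, lo i ≤ hi i)
    {γ cJ bx : ℝ} (hγ : 0 < γ) (hcJ : 0 ≤ cJ) (hbx : 0 ≤ bx)
    (hbxM : ∀ i, 12 * (P.d : ℝ) * ((n i : ℝ) + 2) ^ 2 ≤ bx * (M i) ^ 2)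
    {Cerr R 𝓐 : ι → ℝ} (hM : ∀ i, 1 ≤ (M i)) (hR : ∀ i, 0 < R i) (h𝓐 : ∀ i, 0 ≤ 𝓐 i)
    (n' : ι → ℕ) (hn' : ∀ i, 1 ≤ n' i)
    -- (J1) the JOINT holomorphic extension of the function in the datum perturbation and the field
    (hGj : ∀ i Vk, PlaqSmallOn (plaqsInside (pts (k i) (Z i ∩ (Λ i)ᶜ))) (eR i) Vk →
      ∃ 𝒢 : VecField P (k i) (EuclideanSpace ℂ (Fin 3)) × VecField P (k i) (EuclideanSpace ℂ (Fin 3)) → ℂ,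
        DifferentiableOn ℂ 𝒢 (ball 0 (R i)) ∧
        (∀ z ∈ ball (0 : VecField P (k i) (EuclideanSpace ℂ (Fin 3)) × VecField P (k i) (EuclideanSpace ℂ (Fin 3))) (R i), ‖𝒢 z‖ ≤ 𝓐 i) ∧
        ∀ p B' : VecField P (k i) E3, ‖p‖ < R i → ‖B'‖ < R i →
          𝒢 (cplxVec p, cplxVec B') = ((f i (expMul su2Chart B' (ext i (expMul su2Chart p Vk))) : ℝ) : ℂ))
    -- (L2) (1.7)–(1.9) p.358 for the Hessian of the slice function at `0`
    (hlead : ∀ i Vk, PlaqSmallOn (plaqsInside (pts (k i) (Z i ∩ (Λ i)ᶜ))) (eR i) Vk →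
      ∀ X : GaugeSlice (pts (k i) (Λ i)) (T i) E3,
      |⟪X, (fderiv ℝ (rGrad (pts (k i) (Λ i)) (T i) (sliceFn (pts (k i) (Λ i)) (T i) (f i) (ext i Vk))) 0) X⟫ -
          ∑ a : Fin 3, formDk (n' i) (fun _ : Fin P.d => P.sitesPerDir (k i))
            (ofRealCfg (fun _ : Fin P.d => P.sitesPerDir (k i)) fun j =>
              ιA (pts (k i) (Λ i)) (T i) X ⟨j.1, j.2⟩ a)| ≤ Cerr i * ‖X‖ ^ 2)
    (hsm : ∀ i, Cerr i ≤ (4 / Real.pi ^ 2) ^ (P.d + 2) / (2 * (3 * (K i : ℝ) ^ 2 + 2 * (K i : ℝ) ^ 4)))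
    (hγle : ∀ i, γ / (M i) ^ 5 ≤ (4 / Real.pi ^ 2) ^ (P.d + 2) / (2 * (3 * (K i : ℝ) ^ 2 + 2 * (K i : ℝ) ^ 4)))
    -- (V) the VALUE of the function at the extended regular datum is small (replaces (L3))
    {cA : ℝ}
    (hV : ∀ i ε Vk, 0 < ε → ε ≤ eR i → PlaqSmallOn (plaqsInside (pts (k i) (Z i ∩ (Λ i)ᶜ))) ε Vk → f i (ext i Vk) ≤ cA * ε ^ 2)
    (hcJ' : ∀ i, 2 * cA * eR i / R i + 2 * 𝓐 i / (R i * eR i) ≤ cJ)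
    : ∃ a₁ : ι → ℝ, (∀ i, 0 < a₁ i) ∧
      B15.Prop1Printed (lfVarOn su2Chart fun i =>
        (⟨⟨k i, Z i, Λ i, M i, f i, anExt (pts (k i) (Λ i)) (T i) (f i) (ext i)
          (min (1 / 2) (min (R i / 8) (γ / (M i) ^ 5 * (R i / 2) ^ 2 / (48 * (4 * 𝓐 i / R i + 1)))))⟩,
          domReg (Z i) (k i) (a₁ i)⟩ : InstOn P SU2)) :=
  exists_domain_prop1Printed_lfVarOn_ofFun_intrinsic_analytic hd3 h0 Z Λ k M f hf eR heR T lo hi n hn hN hbox hZ hTG0 hN5 K hK1 hKn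
    ext hext hlohi hγ hcJ hbx hbxM hM hR h𝓐 n' hn' hGj hlead hsm hγle
    (hJ_of_value Z Λ k f hf0 eR heR T ext hR hGj hV hcJ')

end OfFun

/-! ## §3 At `Node00.bgOfRecord av reg`: Proposition 1 from (J1), (L2) and the (1.77) VALUE letter -/

section Record

open Classical

variable {P : Params}

/-- ★★★ **PROPOSITION 1 [IV] WITH ITS ANALYTIC-EXTENSION CLAUSE AT NODE 00's SOLUTION MAP OF RECORD, WITH THE GRADIENT LETTER (L3) REPLACED BY THE
(1.77) VALUE LETTER (V).**  The record endpoint `B15Prop1IntrinsicOfRecord.exists_domain_prop1Printed_lfVarOn_std_su2_box_intrinsic_analytic_ofRecord`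
(p527900) VERBATIM at `bg := Node00.bgOfRecord av reg`, except that `hJ` is gone: in its place (V) `hV : A(U_{k,Z}(ext V_k)) = fun177std bg M₁ Z k
(ext V_k) ≤ cA·ε²` at `ε`-regular data (`ε ≤ eR i`) and the bookkeeping `hcJ' : 2cA·eR i∕R i + 2𝓐 i∕(R i·eR i) ≤ cJ`; `0 ≤ A` is
`Setup.wilsonAction4_nonneg` (`fun177std_eq`).  WHAT A CONSUMER SUPPLIES: (J1) `hGj`, (L2) `hlead` + `hsm`∕`hγle`, (V) `hV` + `hcJ'`, the class
invariance `hreg`, `k i ≤ m + K`, structure — (V) is print's regularity of `U_{k,Z}` on its component ([IV] p. 193 ll. 17–20 *«The corresponding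
configuration U_{k,Z} satisfies the condition |∂U_{k,Z} − 1| < O(1)B₃M²εη²»*, [15] Thm 1 (8)) summed over the component's plaquettes; see the
module docstring for the locality trade against print's `B₃²4ε_k`. [cite: Balaban1989LargeFieldI, Prop. 1 (1.77)–(1.78) p.194 (incl. the last clause),
p.193, (1.74) p.192; Balaban1989LargeFieldII, (1.7)–(1.9) p.358, (1.11) p.358, (1.12)–(1.13) p.359; Balaban1985Variational, Thm 1 (8) p.279, Prop. 9 p.309] -/
theorem exists_domain_prop1Printed_lfVarOn_std_su2_box_intrinsic_analytic_ofRecord_ofValue (hd3 : 3 ≤ P.d) (h0 : 0 < P.d) {ι : Type}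
    (av : ∀ j, Averaging P j SU2) {reg : Set (GaugeField P 0 SU2)}
    (hreg : ∀ (w : GaugeTransf P 0 SU2) (U : GaugeField P 0 SU2), U ∈ reg → gaugeAct w U ∈ reg)
    (M₁ : ℕ) (Z Λ : ι → Set (Site P 0)) (k : ι → ℕ) (M : ι → ℝ) (hk : ∀ i, k i ≤ P.m + P.K)
    (eR : ι → ℝ) (heR : ∀ i, 0 < eR i)
    (T : ∀ i, Finset (PBond P (k i)))
    (lo hi : ι → Fin P.d → ℤ) (n : ι → ℕ) (hn : ∀ i κ, hi i κ ≤ lo i κ + n i) (hN : ∀ i, n i + 2 < P.sitesPerDir (k i))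
    (hbox : ∀ i, pts (k i) (Λ i) = (castSite '' Set.Icc (lo i) (hi i) : Set (Site P (k i))))
    (hZ : ∀ i, (boxPlaqs (lo i - 1) (hi i + 1) : Set (Plaq P (k i))) ⊆ plaqsInside (pts (k i) (Z i)))
    -- (`G₀`: the image is taken with the classical `DecidableEq` instance, as in p527900's statement)
    (hTG0 : ∀ i, T i = @Finset.image (Fin P.d → ℤ) (PBond P (k i)) (fun a b => Classical.propDecidable (a = b))
      (fun x => (⟨castSite (x - unitVec ⟨0, h0⟩), ⟨0, h0⟩⟩ : PBond P (k i))) (box (fun κ => (hi i κ - lo i κ + 1).toNat) (lo i)))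
    (hN5 : ∀ i κ, ((hi i κ - lo i κ + 1).toNat : ℤ) + 5 < P.sitesPerDir (k i))
    (K : ι → ℕ) (hK1 : ∀ i, 1 ≤ K i) (hKn : ∀ i κ, (hi i κ - lo i κ + 1).toNat ≤ K i)
    (ext : ∀ i, GaugeField P (k i) SU2 → GaugeField P (k i) SU2)
    (hext : ∀ i Vk, ext i Vk = extend (pts (k i) (Λ i)) (shellGauge Vk (lo i) (hi i)) Vk)
    (hlohi : ∀ i, lo i ≤ hi i)
    {γ cJ bx : ℝ} (hγ : 0 < γ) (hcJ : 0 ≤ cJ) (hbx : 0 ≤ bx)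
    (hbxM : ∀ i, 12 * (P.d : ℝ) * ((n i : ℝ) + 2) ^ 2 ≤ bx * (M i) ^ 2)
    {Cerr R 𝓐 : ι → ℝ} (hM : ∀ i, 1 ≤ (M i)) (hR : ∀ i, 0 < R i) (h𝓐 : ∀ i, 0 ≤ 𝓐 i)
    (n' : ι → ℕ) (hn' : ∀ i, 1 ≤ n' i)
    -- (J1) the JOINT holomorphic extension of print's function in the datum perturbation and the field
    (hGj : ∀ i Vk, PlaqSmallOn (plaqsInside (pts (k i) (Z i ∩ (Λ i)ᶜ))) (eR i) Vk →
      ∃ 𝒢 : VecField P (k i) (EuclideanSpace ℂ (Fin 3)) × VecField P (k i) (EuclideanSpace ℂ (Fin 3)) → ℂ,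
        DifferentiableOn ℂ 𝒢 (ball 0 (R i)) ∧
        (∀ z ∈ ball (0 : VecField P (k i) (EuclideanSpace ℂ (Fin 3)) × VecField P (k i) (EuclideanSpace ℂ (Fin 3))) (R i), ‖𝒢 z‖ ≤ 𝓐 i) ∧
        ∀ p B' : VecField P (k i) E3, ‖p‖ < R i → ‖B'‖ < R i →
          𝒢 (cplxVec p, cplxVec B') =
            ((fun177std (Node00.bgOfRecord av reg) M₁ (Z i) (k i) (expMul su2Chart B' (ext i (expMul su2Chart p Vk))) : ℝ) : ℂ))
    -- (L2) (1.7)–(1.9) p.358 for the Hessian of the slice function at `0`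
    (hlead : ∀ i Vk, PlaqSmallOn (plaqsInside (pts (k i) (Z i ∩ (Λ i)ᶜ))) (eR i) Vk →
      ∀ X : GaugeSlice (pts (k i) (Λ i)) (T i) E3,
      |⟪X, (fderiv ℝ (rGrad (pts (k i) (Λ i)) (T i)
              (sliceFn (pts (k i) (Λ i)) (T i) (fun177std (Node00.bgOfRecord av reg) M₁ (Z i) (k i)) (ext i Vk))) 0) X⟫ -
          ∑ a : Fin 3, formDk (n' i) (fun _ : Fin P.d => P.sitesPerDir (k i))
            (ofRealCfg (fun _ : Fin P.d => P.sitesPerDir (k i)) fun j =>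
              ιA (pts (k i) (Λ i)) (T i) X ⟨j.1, j.2⟩ a)| ≤ Cerr i * ‖X‖ ^ 2)
    (hsm : ∀ i, Cerr i ≤ (4 / Real.pi ^ 2) ^ (P.d + 2) / (2 * (3 * (K i : ℝ) ^ 2 + 2 * (K i : ℝ) ^ 4)))
    (hγle : ∀ i, γ / (M i) ^ 5 ≤ (4 / Real.pi ^ 2) ^ (P.d + 2) / (2 * (3 * (K i : ℝ) ^ 2 + 2 * (K i : ℝ) ^ 4)))
    -- (V) the VALUE of (1.77) at the extended regular datum is small (replaces (L3))
    {cA : ℝ}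
    (hV : ∀ i ε Vk, 0 < ε → ε ≤ eR i → PlaqSmallOn (plaqsInside (pts (k i) (Z i ∩ (Λ i)ᶜ))) ε Vk →
      fun177std (Node00.bgOfRecord av reg) M₁ (Z i) (k i) (ext i Vk) ≤ cA * ε ^ 2)
    (hcJ' : ∀ i, 2 * cA * eR i / R i + 2 * 𝓐 i / (R i * eR i) ≤ cJ)
    : ∃ a₁ : ι → ℝ, (∀ i, 0 < a₁ i) ∧
      B15.Prop1Printed (lfVarOn su2Chart fun i => InstOn.std (Node00.bgOfRecord av reg) M₁ (Z i) (Λ i) (k i) (M i) (a₁ i)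
        (anExt (pts (k i) (Λ i)) (T i) (fun177std (Node00.bgOfRecord av reg) M₁ (Z i) (k i)) (ext i)
          (min (1 / 2) (min (R i / 8) (γ / (M i) ^ 5 * (R i / 2) ^ 2 / (48 * (4 * 𝓐 i / R i + 1))))))) :=
  exists_domain_prop1Printed_lfVarOn_std_su2_box_intrinsic_analytic_ofRecord hd3 h0 av hreg M₁ Z Λ k M hk eR heR T lo hi n hn hN hbox
    hZ hTG0 hN5 K hK1 hKn ext hext hlohi hγ hcJ hbx hbxM hM hR h𝓐 n' hn' hGj hlead hsm hγle
    (hJ_of_value Z Λ k (fun i => fun177std (Node00.bgOfRecord av reg) M₁ (Z i) (k i))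
      (fun i V => by rw [fun177std_eq]; exact wilsonAction4_nonneg _) eR heR T ext hR hGj hV hcJ')

end Record

end Literature.MathematicalPhysics.QuantumFieldTheory.Balaban1983to89.B15Prop1GradientFromValue

end
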